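import Mathlib
import Literature.MathematicalPhysics.QuantumManyBody.BoseEinsteinCondensation
import Summits.AtomisticToContinuum.BoseEinsteinCondensation.Theses.BECCutLineWeakDisorder

/-!
# Sketch — crux-ideate `stmt-AtomisticToContinuum-9072` (GroundStateRigidity), ideator 2, round 1

First-lemma signatures for the two idea cards (they only need to ELABORATE; nothing is proved):

* `tight-sphere-split`   : `AddClearSphere` (ACS) — the geometric residue the fixed-label
  operator split reduces the hard-sphere case of the crux to; plus the parking lemma
  `WellSeparatedJoined` and the one-particle `InsertionBound`.
* `loose-escape-tax`     : `AllLooseEscapes` (AT) — pointwise geometric input of the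
  tightness-tax line.

Vocabulary: `Space = ℝ³`, `Config N = Fin N → Space`, `box L = (0,L)³`, `sideLength`,
`groundStateEnergy` are the audited conjunct's (`Literature…BoseGas`); `JoinedIn` is Mathlib's.
Hard spheres of exclusion distance `b` in the Dirichlet cube: centres in the OPEN cube, pair
distances `> b` (the interior of `{interaction (⊤·1_{[0,b]}) ≠ ⊤}`; walls constrain centres only).
-/

noncomputable section

namespace Summit.AtomisticToContinuum.BoseEinsteinCondensation.Cruxes.GroundStateRigidity.Sketch

open Literature.MathematicalPhysics.QuantumManyBody.BoseGas
open scoped ENNReal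

/-- Free region of `N` hard spheres (exclusion distance `b`) in the Dirichlet cube of side `L`. -/
def hardSphereFree (N : ℕ) (L b : ℝ) : Set (Config N) :=
  {X | (∀ i, X i ∈ box L) ∧ ∀ i j : Fin N, i ≠ j → b < dist (X i) (X j)}

/-- `3b`-separated ("parked") configurations: pairwise `≥ 3b`, every coordinate in `[3b/2, L-3b/2]`. -/
def WellSeparated (N : ℕ) (L b : ℝ) : Set (Config N) :=
  {X | (∀ i (k : Fin 3), X i k ∈ Set.Icc (3 * b / 2) (L - 3 * b / 2)) ∧
        ∀ i j : Fin N, i ≠ j → 3 * b ≤ dist (X i) (X j)}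

/-- `y` is `K`-clear with respect to the configuration `X`: farther than `(K+1)b` from every
centre of `X` and at least `Kb` from every face of the cube. -/
def IsClear (K b L : ℝ) {n : ℕ} (X : Config n) (y : Space) : Prop :=
  (∀ j, (K + 1) * b < dist y (X j)) ∧ ∀ k : Fin 3, y k ∈ Set.Icc (K * b) (L - K * b)

/-- PARKING LEMMA (support, provable now): at low density all `3b`-separated configurations lie
in ONE path component of the free region (the principal component `F`). -/
def WellSeparatedJoined : Prop :=
  ∃ c₀ : ℝ, 0 < c₀ ∧ ∀ (N : ℕ) (L b : ℝ), 0 < b → (N : ℝ) * b ^ 3 ≤ c₀ * L ^ 3 →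
    ∀ X ∈ WellSeparated N L b, ∀ Y ∈ WellSeparated N L b,
      JoinedIn (hardSphereFree N L b) X Y

/-- (ACS) ADD-A-CLEAR-SPHERE — first lemma of card `tight-sphere-split`.  If the `n` spheres
`X` can be untangled inside the free region to a `3b`-separated configuration, and `y` is
`K`-clear with respect to `X`, then the `(n+1)`-configuration `y :: X` can be untangled too.
(One extra well-separated sphere can always dodge along some untangling path.) -/
def AddClearSphere : Prop :=
  ∃ K c₀ : ℝ, 0 < K ∧ 0 < c₀ ∧ ∀ (n : ℕ) (L b : ℝ), 0 < b → ((n : ℝ) + 1) * b ^ 3 ≤ c₀ * L ^ 3 →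
    ∀ X : Config n, (∃ Y ∈ WellSeparated n L b, JoinedIn (hardSphereFree n L b) X Y) →
      ∀ y : Space, IsClear K b L X y →
        ∃ Z ∈ WellSeparated (n + 1) L b,
          JoinedIn (hardSphereFree (n + 1) L b) (Matrix.vecCons y X) Z

/-- The single-sphere cell constraint: positions `z` for sphere `i` with all other spheres of
`X` frozen. -/
def cellSet {n : ℕ} (L b : ℝ) (X : Config (n + 1)) (i : Fin (n + 1)) : Set Space :=
  {z | z ∈ box L ∧ ∀ j : Fin (n + 1), j ≠ i → b < dist z (X j)}

/-- Sphere `i` is `K`-LOOSE at `X`: with the others frozen it can be moved, inside its cell,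
to a `K`-clear point. (`K`-TIGHT is the negation: its cell has inradius `≤ Kb`, so its
fibrewise Dirichlet kinetic energy is `≥ α_K / b²`.) -/
def IsLoose (K L b : ℝ) {n : ℕ} (X : Config (n + 1)) (i : Fin (n + 1)) : Prop :=
  ∃ z : Space, JoinedIn (cellSet L b X i) (X i) z ∧
    IsClear K b L (fun j : Fin n => X (i.succAbove j)) z

/-- (AT) ALL-LOOSE ⟹ ESCAPABLE — first lemma of card `loose-escape-tax`.  A free
configuration in which EVERY sphere is `K`-loose lies in the principal component.
Contrapositive: at every configuration of a non-principal component some sphere is `K`-tight. -/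
def AllLooseEscapes : Prop :=
  ∃ K c₀ : ℝ, 0 < K ∧ 0 < c₀ ∧ ∀ (n : ℕ) (L b : ℝ), 0 < b → ((n : ℝ) + 1) * b ^ 3 ≤ c₀ * L ^ 3 →
    ∀ X ∈ hardSphereFree (n + 1) L b, (∀ i, IsLoose K L b X i) →
      ∃ Z ∈ WellSeparated (n + 1) L b, JoinedIn (hardSphereFree (n + 1) L b) X Z

/-- ONE-PARTICLE INSERTION BOUND (support of both cards; hole-averaged IMS trial state,
uniform in `n`): for an admissible `v` of range `R₀`, adding one particle to the Dirichlet box at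
density `≤ ρ` costs at most `C ρ^{2/3}` — the "chemical potential" the tight-sphere floor must beat. -/
def InsertionBound (v : ℝ → ℝ≥0∞) : Prop :=
  ∃ C c₀ : ℝ, 0 < C ∧ 0 < c₀ ∧ ∀ (n : ℕ) (L : ℝ), 0 < L →
    ∀ R₀ : ℝ, (∀ r, R₀ < r → v r = 0) → ((n : ℝ) + 1) * R₀ ^ 3 ≤ c₀ * L ^ 3 →
      groundStateEnergy v (n + 1) L ≤
        groundStateEnergy v n L + ENNReal.ofReal (C * (((n : ℝ) + 1) / L ^ 3) ^ (2 / 3 : ℝ))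


/-! ### Card `breathing-no-sparse-jamming`: Morse-theoretic route to cube connectivity -/

/-- `X` lies strictly above level `t` of the min-type ("tautological") function
`s(X) = min( min_{i<j} (|xᵢ-xⱼ| - b)/2 , min_i dist(xᵢ, ∂cube) )`: all pair gaps exceed `b + 2t`
and all centres are more than `t` inside the cube.  `LevelAbove b L 0 = hardSphereFree`. -/
def LevelAbove (b L t : ℝ) {n : ℕ} (X : Config n) : Prop :=
  (∀ i (k : Fin 3), X i k ∈ Set.Ioo t (L - t)) ∧ ∀ i j : Fin n, i ≠ j → b + 2 * t < dist (X i) (X j)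

/-- (NSJ) NO SPARSE LOCAL MAXIMUM ("no dilute collectively-jammed backbone braced on the cube") —
first lemma of card `breathing-no-sparse-jamming`.  At packing fraction `≤ c₀`, a free
configuration that is NOT above level `κb` is not a local maximum of `s`: arbitrarily close to it
there is a configuration at a strictly higher level (a strict "breathing" expansion exists).  By
Baryshnikov–Bubenik–Kahle, local maxima of `s` are balanced self-stressed contact frameworks
touching two opposite faces; the claim is that dilute ones always admit a second-order strict
expansion. -/
def NoSparseLocalMax : Prop :=
  ∃ c₀ κ : ℝ, 0 < c₀ ∧ 0 < κ ∧ ∀ (n : ℕ) (L b : ℝ), 0 < b → (n : ℝ) * b ^ 3 ≤ c₀ * L ^ 3 →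
    ∀ X ∈ hardSphereFree n L b, ¬ LevelAbove b L (κ * b) X →
      ∀ ε : ℝ, 0 < ε → ∃ Y : Config n, dist X Y < ε ∧ ∃ t : ℝ, LevelAbove b L t Y ∧ ¬ LevelAbove b L t X

/-- The Dirichlet-cube analogue of `HardCoreExtension.Disproof.LemmaGConnected` (torus), which
`NoSparseLocalMax` + the parking lemma at level `κb` imply by min-type Morse theory (the supremum
of `s` over a path component of the free region is attained inside it): the dilute hard-sphere
configuration space in the cube is path-connected (even with labels). -/
def CubeConnected : Prop :=
  ∃ c₀ : ℝ, 0 < c₀ ∧ ∀ (n : ℕ) (L b : ℝ), 0 < b → (n : ℝ) * b ^ 3 ≤ c₀ * L ^ 3 →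
    ∀ X ∈ hardSphereFree n L b, ∀ Y ∈ hardSphereFree n L b, JoinedIn (hardSphereFree n L b) X Y

/-- Morse step (support, provable now): no local maximum below level `κb` + parking ⟹ connected. -/
def MorseStep : Prop := NoSparseLocalMax → WellSeparatedJoined → CubeConnected

/-- The crux, restated verbatim for reference (the cards conclude THIS by name in crux-plan). -/
def CruxVerbatim : Prop :=
  ∀ v : ℝ → ENNReal, IsRepulsiveFiniteRange v → ∃ ρ₀ : ℝ, 0 < ρ₀ ∧ ∀ ρ : ℝ, 0 < ρ → ρ < ρ₀ →
    ∀ᶠ N : ℕ in Filter.atTop, ∀ η : ℝ, 0 < η → ∃ δ : ENNReal, 0 < δ ∧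
      ∀ Ψ Φ : TrialState N (sideLength ρ N),
        energy v Ψ ≤ groundStateEnergy v N (sideLength ρ N) + δ →
        energy v Φ ≤ groundStateEnergy v N (sideLength ρ N) + δ →
          ∃ c : ℂ, ‖c‖ = 1 ∧ ∫⁻ X, (‖Ψ.ψ X - c * Φ.ψ X‖₊ : ENNReal) ^ 2 ≤ ENNReal.ofReal η

/-- Sanity: the verbatim restatement IS the route decl (so a crux-plan skeleton can conclude it by name). -/
example : CruxVerbatim ↔
    Summit.AtomisticToContinuum.BoseEinsteinCondensation.Theses.BECCutLineWeakDisorder.GroundStateRigidity :=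
  Iff.rfl

end Summit.AtomisticToContinuum.BoseEinsteinCondensation.Cruxes.GroundStateRigidity.Sketch

end
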